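import Summits.AtomisticToContinuum.Crystallization.Theorems.ExcessDecayLiouvilleStepGradient
import Summits.AtomisticToContinuum.Crystallization.Theorems.ExcessDecayLiouvilleNonlinearCaccioppoliIterAbs

/-!
# Route `ExcessDecayLiouville`: the gradient mass of one step at a centre, forcing absorbed (nonlinear half, XI′)

Harmonic-replacement architecture for item `ExcessDecay` (stmt-AtomisticToContinuum-9334), nonlinear half.
`step_gradient'` is `step_gradient` built on `gradient_mass_le'`: the forcing of the rows enters only through a
bound `Φ₀` of its norm on `SR ∩ B_{b₁}(c₀)`, as the mass-free term `(Φ₀ √(32b₁³)(400b₁/189 + 2))²/κ`; every other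
term is doubled, and the flux smallness is `4·10⁶ Λ ≤ κ/16`.
All `[folklore]`; helper lemmas, nothing here closes an item.
-/

noncomputable section

namespace Summit.AtomisticToContinuum.Crystallization.Theorems.ExcessDecayLiouville

open scoped BigOperators Topology InnerProductSpace RealInnerProductSpace Classical
open Literature.MathematicalPhysics.StatisticalMechanics
open Summit.AtomisticToContinuum.Crystallization.Theorems.PhononStabilityNegative

-- Local notation: the force-constant map `K(e)w = h(|e|²)w + 2⟪e,w⟫h′(|e|²)e`.
local notation3 "𝕂[" e "] " w:max =>
  (-((‖e‖ ^ 2)⁻¹) ^ 7 + ((‖e‖ ^ 2)⁻¹) ^ 4) • w + (2 * ⟪e, w⟫ * (7 * ((‖e‖ ^ 2)⁻¹) ^ 8 - 4 * ((‖e‖ ^ 2)⁻¹) ^ 5)) • e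
-- Local notation: the pair force `F(x) = h(|x|²) x`.
local notation3 "𝐅[" x "]" => ((-((‖x‖ ^ 2)⁻¹) ^ 7 + ((‖x‖ ^ 2)⁻¹) ^ 4) • x)
set_option quotPrecheck false in
-- Local notation: ball indicator.
local notation "𝟙ᵇ[" x ", " c ", " R "]" => (if dist (x : EuclideanSpace ℝ (Fin 3)) c ≤ R then (1 : ℝ) else 0)

section

variable {X : Set (EuclideanSpace ℝ (Fin 3))} {c : EuclideanSpace ℝ (Fin 3)} {r ε κ : ℝ}
  {t : Fin 2 → EuclideanSpace ℝ (Fin 3)} {A : EuclideanSpace ℝ (Fin 3) →L[ℝ] EuclideanSpace ℝ (Fin 3)}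
  {π : EuclideanSpace ℝ (Fin 3) → EuclideanSpace ℝ (Fin 3)}
  {aff : (EuclideanSpace ℝ (Fin 3)) → (EuclideanSpace ℝ (Fin 3))} {a : Fin 2 → EuclideanSpace ℝ (Fin 3)}
  {B : (EuclideanSpace ℝ (Fin 3)) →L[ℝ] (EuclideanSpace ℝ (Fin 3))} {x₀ c₀ : EuclideanSpace ℝ (Fin 3)}

variable (hA : Adm₀ A) (hI : Inner₀ t A)

set_option quotPrecheck false in
-- Local notation: the operator row `(L v)(p)`.
local notation "𝕃" v:max " @ " p:max =>
  tsum (fun q : Sites₀ t A => (if ((p : Sites₀ t A) : EuclideanSpace ℝ (Fin 3)) ≠ q then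
    𝕂[((p : Sites₀ t A) : EuclideanSpace ℝ (Fin 3)) - q] (v ((p : Sites₀ t A) : EuclideanSpace ℝ (Fin 3)) - v q) else 0))
set_option quotPrecheck false in
-- Local notation: the finite near-neighbour form on the ball of radius `X` about `c₀`.
local notation "NN[" v ", " X "]" =>
  (∑ p ∈ (finite_sites_dist_le (t := t) (A := A) hA hI c₀ X).toFinset,
    ∑ q ∈ (finite_sites_dist_le (t := t) (A := A) hA hI c₀ X).toFinset,
      (if p ≠ q ∧ dist p q ≤ 11 / 10 then ‖v p - v q‖ ^ 2 else (0 : ℝ)))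
set_option quotPrecheck false in
-- local mass on the ball of radius `X` about `c₀`
local notation "𝐌[" f ", " X "]" =>
  tsum (fun p : Sites₀ t A => ‖f (p : EuclideanSpace ℝ (Fin 3))‖ ^ 2 * 𝟙ᵇ[p, c₀, X])
set_option quotPrecheck false in
-- weighted far mass with floor `Y` about `c₀`
local notation "𝐉[" f ", " Y "]" =>
  tsum (fun q : Sites₀ t A => ‖f (q : EuclideanSpace ℝ (Fin 3))‖ ^ 2 * (max (dist (q : EuclideanSpace ℝ (Fin 3)) c₀) Y)⁻¹ ^ 8)

include hA hI in
/-- **The gradient mass of one step at a centre, forcing absorbed** (see the module docstring). [folklore] -/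
theorem step_gradient' (hκ0 : 0 < κ)
    (hκ : ∀ v : (EuclideanSpace ℝ (Fin 3)) → (EuclideanSpace ℝ (Fin 3)), (Function.support v).Finite →
      Function.support v ⊆ Sites₀ t A → κ * nnForm t A v ≤ ∑' p : Sites₀ t A, ⟪𝕃 v @ p, v p⟫)
    (hX : X.Finite) (hequil : Equil₀ X)
    (hπ : ∀ s' ∈ Sites₀ t A, dist s' c ≤ r → π s' ∈ X ∧ dist (π s') s' ≤ ε)
    (hinj : ∀ s₁ ∈ Sites₀ t A, ∀ s₂ ∈ Sites₀ t A, dist s₁ c ≤ r → dist s₂ c ≤ r → π s₁ = π s₂ → s₁ = s₂)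
    (SR : Finset (EuclideanSpace ℝ (Fin 3))) (hSR : ∀ x, x ∈ SR ↔ x ∈ Sites₀ t A ∧ dist x c ≤ r)
    (χ : EuclideanSpace ℝ (Fin 3) → ℝ) (hχ0 : ∀ q ∈ Sites₀ t A, q ∉ SR → χ q = 0) (hχS : ∀ x, x ∉ Sites₀ t A → χ x = 0)
    (hχabs : ∀ x, |χ x| ≤ 1) {Rχ : ℝ} (hRχ : Rχ ≤ r) (hχone : ∀ q ∈ SR, dist q c ≤ Rχ → χ q = 1)
    (haff : ∀ (m : Fin 2) (z : EuclideanSpace ℝ (Fin 3)), z ∈ Λ₀ → aff (t m + A z) = a m + B (t m + A z - x₀))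
    {D₀ : ℝ} (hD₀ : 0 ≤ D₀) (hD₀' : D₀ ≤ 1 / 10) (hsmall : ‖a 0 - a 1‖ + 2 * r * ‖B‖ ≤ 1 / 50)
    (hD : ∀ x ∈ SR, ‖(π x - x) - aff x‖ ≤ D₀ / 2)
    (hv : (Function.support (fun x => χ x • ((π x - x) - aff x))).Finite)
    (hΛκ : 4000000 * (210000 * ((25 / 23) * (D₀ + ‖a 0 - a 1‖) + ‖B‖)) ≤ κ / 16)
    {a₁ b₁ : ℝ} (ha₁ : 1 ≤ a₁) (hab : a₁ < b₁) (hgeom : dist c₀ c + b₁ ≤ Rχ)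
    {Φ₀ : ℝ} (hΦ₀ : 0 ≤ Φ₀)
    (hφ : ∀ p ∈ SR, dist p c₀ ≤ b₁ → ‖(fun s : EuclideanSpace ℝ (Fin 3) =>
            (-(∑ s' ∈ SR.erase s, 𝐅[(s - s') + (aff s - aff s')]) -
              (∑ q ∈ (hX.toFinset.erase (π s)) \ ((SR.erase s).image π),
                (deriv lennardJones (dist (π s) q) / dist (π s) q) • (π s - q)) +
              ((∑ s' ∈ SR.erase s, 𝕂[s - s'] ((1 - χ s') • ((π s' - s') - aff s'))) +
                ∑' q : ↑((SR.subtype (· ∈ Sites₀ t A) : Set (Sites₀ t A)))ᶜ,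
                  (if s ≠ (q : EuclideanSpace ℝ (Fin 3)) then 𝕂[s - (q : EuclideanSpace ℝ (Fin 3))] ((π s - s) - aff s) else 0)))) p‖ ≤ Φ₀) :
    NN[(fun x => χ x • ((π x - x) - aff x)), a₁] ≤ 2 ^ (5 + 1) *
        ((2 * ((2 / κ * (19 * 16 * (1024 / ((23 / 25 : ℝ) ^ 3 * (23 / 25 : ℝ) ^ 3))) +
            16 * (11 / 10 : ℝ) ^ 8 * (1024 / ((23 / 25 : ℝ) ^ 3 * (23 / 25 : ℝ) ^ 3))) *
            𝐌[(fun x => χ x • ((π x - x) - aff x)), 2 * b₁]) * (b₁ - a₁) ^ 3 +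
          2 * (2 / κ * (38 * 4 ^ 5 * (1024 / (23 / 25 : ℝ) ^ 3) * 𝐌[(fun x => χ x • ((π x - x) - aff x)), 2 * b₁] +
            (210000 * ((25 / 23) * (D₀ + ‖a 0 - a 1‖) + ‖B‖)) * 20 ^ 5 * ((7 / 2) * (1024 / (23 / 25 : ℝ) ^ 3) *
              (∑ x ∈ SR.filter (fun p => dist p c₀ ≤ b₁), ‖(fun x => χ x • ((π x - x) - aff x)) x‖ ^ 2) +
              ((1024 / (23 / 25 : ℝ) ^ 3) * (∑ q ∈ SR.filter (fun q => dist q c₀ ≤ 2 * b₁), ‖(fun x => (π x - x) - aff x) q‖ ^ 2)) / 2))) +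
          120 ^ 5 * NN[(fun x => χ x • ((π x - x) - aff x)), b₁]) / (b₁ - a₁) ^ 5) +
      2 * (2 * (2 / κ * ((Φ₀ * Real.sqrt (32 * b₁ ^ 3) * (400 * b₁ / 189 + 2)) ^ 2 / κ +
          (210000 * ((25 / 23) * (D₀ + ‖a 0 - a 1‖) + ‖B‖)) *
            (8192 * b₁ ^ 3 * ∑ q ∈ SR.filter (fun q => ¬ dist q c₀ ≤ 2 * b₁),
              (dist q c₀)⁻¹ ^ 8 * ‖(fun x => (π x - x) - aff x) q‖ ^ 2) / 2 +
          19 * 8192 * b₁ ^ 3 * 𝐉[(fun x => χ x • ((π x - x) - aff x)), a₁]))) := by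
  have hSRS : ∀ x ∈ SR, x ∈ Sites₀ t A := fun x hx => ((hSR x).1 hx).1
  have ha₁0 : 0 < a₁ := by linarith
  -- bound on the field
  have hfB : ∀ x, ‖(fun x => χ x • ((π x - x) - aff x)) x‖ ≤ D₀ / 2 := by
    intro x
    simp only [norm_smul, Real.norm_eq_abs]
    by_cases hx : x ∈ SR
    · calc |χ x| * ‖(π x - x) - aff x‖ ≤ 1 * (D₀ / 2) := mul_le_mul (hχabs x) (hD x hx) (norm_nonneg _) zero_le_one
        _ = D₀ / 2 := one_mul _
    · have h0 : χ x = 0 := by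
        by_cases hxS : x ∈ Sites₀ t A
        · exact hχ0 x hxS hx
        · exact hχS x hxS
      rw [h0, abs_zero, zero_mul]; linarith
  -- geometry of the balls about c₀
  have hball : ∀ x : EuclideanSpace ℝ (Fin 3), dist x c₀ ≤ b₁ → dist x c ≤ Rχ := by
    intro x hx
    have := dist_triangle x c₀ c
    linarith
  have hSRball : ∀ x ∈ Sites₀ t A, dist x c₀ ≤ b₁ → x ∈ SR := fun x hx hxd =>
    (hSR x).2 ⟨hx, by linarith [hball x hxd]⟩
  -- rows, flux
  have hrows := step_rows hA hI hX hequil hπ hinj SR hSR χ hχ0 hv (aff := aff)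
  obtain ⟨hanti, hΦ⟩ := step_flux hA hI haff SR hSR hD₀ hD₀' hsmall hD (π := π)
  have hrow' : ∀ p : Sites₀ t A, (p : EuclideanSpace ℝ (Fin 3)) ∈ SR → dist (p : EuclideanSpace ℝ (Fin 3)) c₀ ≤ b₁ →
      𝕃 (fun x => χ x • ((π x - x) - aff x)) @ p = _ := fun p hp hpd => hrows p hp (hχone p hp (hball p hpd))
  have hvt : ∀ x ∈ Sites₀ t A, dist x c₀ ≤ b₁ →
      (fun x => (π x - x) - aff x) x = (fun x => χ x • ((π x - x) - aff x)) x := by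
    intro x hx hxd
    simp only []
    rw [hχone x (hSRball x hx hxd) (hball x hxd), one_smul]
  -- far flux data
  have hΘ2 : ∀ R L : ℝ, R ≤ b₁ → 1 ≤ L → ∑ p ∈ SR.filter (fun p => dist p c₀ ≤ R),
      ∑ q ∈ (SR.erase p).filter (fun q => ¬ dist p q ≤ L), (dist p q)⁻¹ ^ 8 * ‖(fun x => (π x - x) - aff x) q‖ ^ 2 ≤
      ((1024 / (23 / 25 : ℝ) ^ 3) * (∑ q ∈ SR.filter (fun q => dist q c₀ ≤ 2 * b₁), ‖(fun x => (π x - x) - aff x) q‖ ^ 2)) / L ^ 5 +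
      8192 * b₁ ^ 3 * ∑ q ∈ SR.filter (fun q => ¬ dist q c₀ ≤ 2 * b₁),
        (dist q c₀)⁻¹ ^ 8 * ‖(fun x => (π x - x) - aff x) q‖ ^ 2 := by
    intro R L hR hL
    have h := far_flux_sq_le hA hI (fun x => (π x - x) - aff x) SR hSRS c₀ (b := b₁) (by linarith) hR hL
    refine h.trans (le_of_eq ?_)
    have hL0 : L ≠ 0 := by intro h0; rw [h0] at hL; norm_num at hL
    congr 1
    field_simp
  -- signs
  have hΛ0 : 0 ≤ 210000 * ((25 / 23) * (D₀ + ‖a 0 - a 1‖) + ‖B‖) := by positivity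
  have hΘ₀0 : 0 ≤ (1024 / (23 / 25 : ℝ) ^ 3) * (∑ q ∈ SR.filter (fun q => dist q c₀ ≤ 2 * b₁), ‖(fun x => (π x - x) - aff x) q‖ ^ 2) := by
    positivity
  have hΘ₁0 : 0 ≤ 8192 * b₁ ^ 3 * ∑ q ∈ SR.filter (fun q => ¬ dist q c₀ ≤ 2 * b₁),
      (dist q c₀)⁻¹ ^ 8 * ‖(fun x => (π x - x) - aff x) q‖ ^ 2 :=
    mul_nonneg (mul_nonneg (by norm_num) (pow_nonneg (by linarith) 3)) (Finset.sum_nonneg fun _ _ => by positivity)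
  exact gradient_mass_le' hA hI hκ0 hκ hv hfB ha₁0 le_rfl hab SR hSRS hSRball _ _ hrow' hanti hΦ₀ hφ hΛ0 hΘ₀0 hΘ₁0 hΛκ hΦ hvt hΘ2


end

end Summit.AtomisticToContinuum.Crystallization.Theorems.ExcessDecayLiouville

end
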